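import Mathlib
import HarnessLib
import Summits.Parity.GeneralizedHardyLittlewood.Theorems.ScaleTauberianCarvingDefs
import Literature.NumberTheory.Sieve.SingularSeries

/-!
# Root existence conservation — definitions (decomp-parity cycle-2 certificate, trap T22; lens-6 g9)

Vocabulary for `Theorems/RootExistenceConservation.lean`, the LEAN-STATED BLOCKER CERTIFICATE at the root
`Parity := BatemanHorn ∧ GeneralizedHardyLittlewood` built from the lens-6 g8 kernel «ExistenceConservation»
(critic CLEARED as CERTIFICATE and adopted as STANDING TRAP T22 «existence conservation / poverty-vacuity test»,
HOME/STATUS.md l.440; operator CYCLE-2 ORDER, writer ACK l.439).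

* §1 shapes of ONE counting sequence `c : ℕ → ℝ` against poverty: `Poor` (`c = o(N)`), `Exact`, `Upper`, `Lower`,
  `ChebyshevEv`, `ChebyshevIO`, `Sync`, `TwoScale`, `LogExact`, `Dichotomy`;
* §3 the twin objects `X h N = Σ_{n≤N} Λ(n)Λ(n+h)`, `Spair h = 𝔖({0,h})`, the worlds `TwinPoor := Poor (X 2)` and
  `AllPairsPoor`;
* §4 the Green–Tao pattern layer at one affine system: `PoorAt`, `UpperAt`, `LowerAt`, `SubstantialAt`, `HomogAt`
  (over the tree's `vonMangoldtSum` / `archFactor` / `singularProduct` / `realBox` and the landed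
  `ScaleTauberianCarving.dil`).

Definitions only; no statements (Defs-file precedent: `ScaleTauberianCarvingDefs`, `FixedLowerQualitativeCoreDefs`).
-/

open scoped BigOperators
open Finset

namespace Summit.Parity.GeneralizedHardyLittlewood.ExistenceConservation

/-! ## §1 Shapes of ONE counting sequence `c : ℕ → ℝ` (think `c N = Σ_{n≤N} Λ(n)Λ(n+2)`) against poverty -/

/-- Poverty: `c N = o(N)` («finitely many prime points», Λ-currency). -/
def Poor (c : ℕ → ℝ) : Prop :=
  ∀ ε : ℝ, 0 < ε → ∃ N₀ : ℕ, ∀ N : ℕ, N₀ ≤ N → |c N| ≤ ε * N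

/-- Exactness with main term `m·N` (Hardy–Littlewood shape). -/
def Exact (c : ℕ → ℝ) (m : ℝ) : Prop :=
  ∀ ε : ℝ, 0 < ε → ∃ N₀ : ℕ, ∀ N : ℕ, N₀ ≤ N → |c N - m * N| ≤ ε * N

/-- One-sided upper shape (`FixedUpper` at one pattern, scalar main term). -/
def Upper (c : ℕ → ℝ) (m : ℝ) : Prop :=
  ∀ ε : ℝ, 0 < ε → ∃ N₀ : ℕ, ∀ N : ℕ, N₀ ≤ N → c N - m * N ≤ ε * N

/-- One-sided lower shape (`FixedLower` at one pattern). -/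
def Lower (c : ℕ → ℝ) (m : ℝ) : Prop :=
  ∀ ε : ℝ, 0 < ε → ∃ N₀ : ℕ, ∀ N : ℕ, N₀ ≤ N → m * N - c N ≤ ε * N

/-- Chebyshev-order lower bound EVENTUALLY (antecedent of `TwinResidualRel`, Λ-form of stmt-Parity-18377). -/
def ChebyshevEv (c : ℕ → ℝ) : Prop :=
  ∃ κ : ℝ, 0 < κ ∧ ∃ N₀ : ℕ, ∀ N : ℕ, N₀ ≤ N → κ * N ≤ c N

/-- Chebyshev-order lower bound INFINITELY OFTEN. -/
def ChebyshevIO (c : ℕ → ℝ) : Prop :=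
  ∃ κ : ℝ, 0 < κ ∧ ∀ N₀ : ℕ, ∃ N : ℕ, N₀ ≤ N ∧ κ * N < c N

/-- Synchronisation of two families (`PairSync` shape): `c₁/m₁` and `c₂/m₂` agree to `o(N)`, no value asserted. -/
def Sync (c₁ c₂ : ℕ → ℝ) (m₁ m₂ : ℝ) : Prop :=
  ∀ ε : ℝ, 0 < ε → ∃ N₀ : ℕ, ∀ N : ℕ, N₀ ≤ N → |c₁ N * m₂ - c₂ N * m₁| ≤ ε * N

/-- Two-scale rigidity of the normalised signed error on the window `[N, N²]` (`ScaleRigidityAt` shape, d = 1,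
scalar main term). -/
def TwoScale (c : ℕ → ℝ) (m : ℝ) : Prop :=
  ∀ ε : ℝ, 0 < ε → ∃ N₀ : ℕ, ∀ N : ℕ, N₀ ≤ N → ∀ n : ℕ, N ≤ n → n ≤ N ^ 2 →
    |(c N - m * N) / N - (c n - m * n) / n| ≤ ε

/-- Log-window exactness (`LogWindowHLAt` shape, d = 1, scalar main term). -/
def LogExact (c : ℕ → ℝ) (m : ℝ) : Prop :=
  ∀ ε : ℝ, 0 < ε → ∃ N₀ : ℕ, ∀ N : ℕ, N₀ ≤ N → ∀ M : ℕ, N ^ 2 ≤ M →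
    |∑ n ∈ Ioc N M, (c n / n - m) / n| ≤ ε * ∑ n ∈ Ioc N M, (1 : ℝ) / n

/-- «Rare or exact» (`BiasDichotomy` shape at one pattern). -/
def Dichotomy (c : ℕ → ℝ) (m : ℝ) : Prop :=
  ∀ ε : ℝ, 0 < ε → ∃ N₀ : ℕ, ∀ N : ℕ, N₀ ≤ N → c N * |c N - m * N| ≤ ε * N * (N + |m * N|)

/-! ## §3 The twin objects -/

open scoped ArithmeticFunction.vonMangoldt
open Literature.NumberTheory.Sieve

/-- `X h N = Σ_{n ≤ N} Λ(n)Λ(n+h)`. -/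
noncomputable def X (h N : ℕ) : ℝ := ∑ n ∈ Finset.Icc 1 N, Λ n * Λ (n + h)

/-- `𝔖(h) = singularSeries {0, h}`. -/
noncomputable def Spair (h : ℕ) : ℝ := singularSeries ({0, (h : ℤ)} : Finset ℤ)

/-- The twin poverty world: `Σ_{n≤N} Λ(n)Λ(n+2) = o(N)` (Λ-form of «finitely many twin primes»). -/
def TwinPoor : Prop := Poor (X 2)

/-- The all-poor ghost world: every even shift pair is poor (every infinite-complexity pair bias is 0). -/
def AllPairsPoor : Prop := ∀ h : ℕ, h ≠ 0 → Even h → Poor (X h)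

/-! ## §4 The Green–Tao pattern layer at one affine system -/

open ScaleTauberianCarving (dil)

variable {d t : ℕ}

/-- Pattern poverty: the system `Ψ` has `o(N^d)` (Λ-weighted) prime points on every convex body. -/
def PoorAt (Ψ : Fin t → AffLinForm d) : Prop :=
  ∀ ε : ℝ, 0 < ε → ∃ N₀ : ℕ, ∀ N : ℕ, N₀ ≤ N → ∀ K : Set (Fin d → ℝ), Convex ℝ K → K ⊆ realBox d N →
    |vonMangoldtSum Ψ K N| ≤ ε * (N : ℝ) ^ d

/-- `FixedUpper` at one system. -/
def UpperAt (Ψ : Fin t → AffLinForm d) : Prop :=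
  ∀ ε : ℝ, 0 < ε → ∃ N₀ : ℕ, ∀ N : ℕ, N₀ ≤ N → ∀ K : Set (Fin d → ℝ), Convex ℝ K → K ⊆ realBox d N →
    vonMangoldtSum Ψ K N - archFactor Ψ K * singularProduct Ψ ≤ ε * (N : ℝ) ^ d

/-- `FixedLower` at one system. -/
def LowerAt (Ψ : Fin t → AffLinForm d) : Prop :=
  ∀ ε : ℝ, 0 < ε → ∃ N₀ : ℕ, ∀ N : ℕ, N₀ ≤ N → ∀ K : Set (Fin d → ℝ), Convex ℝ K → K ⊆ realBox d N →
    archFactor Ψ K * singularProduct Ψ - vonMangoldtSum Ψ K N ≤ ε * (N : ℝ) ^ d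

/-- A pattern is SUBSTANTIAL if along some admissible bodies its main term is `≥ μN^d` (true for every admissible
system on the full box; recorded as a hypothesis, it has no prime content). -/
def SubstantialAt (Ψ : Fin t → AffLinForm d) : Prop :=
  ∃ μ : ℝ, 0 < μ ∧ ∃ N₁ : ℕ, ∀ N : ℕ, N₁ ≤ N → ∃ K : Set (Fin d → ℝ), Convex ℝ K ∧ K ⊆ realBox d N ∧
    μ * (N : ℝ) ^ d ≤ archFactor Ψ K * singularProduct Ψ

/-- Main-term homogeneity along dilation chains on the window `[N, N²]` (a regularity statement about
`β_∞ · 𝔖` only — no prime content; recorded as a hypothesis). -/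
def HomogAt (Ψ : Fin t → AffLinForm d) : Prop :=
  ∀ ε : ℝ, 0 < ε → ∃ N₀ : ℕ, ∀ N : ℕ, N₀ ≤ N → ∀ n : ℕ, N ≤ n → n ≤ N ^ 2 →
    ∀ K : Set (Fin d → ℝ), Convex ℝ K → K ⊆ realBox d N →
      |archFactor Ψ K * singularProduct Ψ / (N : ℝ) ^ d -
        archFactor Ψ (dil N n K) * singularProduct Ψ / (n : ℝ) ^ d| ≤ ε

end Summit.Parity.GeneralizedHardyLittlewood.ExistenceConservation
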